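import Mathlib
import Summits.Ventures.PercRepro2.SkeletonRegion

/-!
# Nonzero edges of a reduct lift to walks of the instance; the one-hub class of the unmarked region
(blind cell PercRepro2, night-1 g17; NIGHT1-G17.md §2)

* **`NzWalk p ends P x y`** — a walk of nonzero edges from `x` to `y` all of whose INTERIOR vertices
  satisfy `P`; **`IsolatedIn q ends' v`** — `v` carries no nonzero edge;
* **`nzWalk_of_reduces`** — every nonzero edge `{x, y}` of a reduct `J` of `I` is the contraction of
  a walk of nonzero edges of `I` from `x` to `y` whose interior vertices are unmarked and carry no
  nonzero edge in `J` (the contracted vertices; proved move by move);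
* **`HMF_of_region_hub`** / **`HCov_of_region_hub`** — the ONE-HUB CLASS OF THE UNMARKED REGION:
  `u` unmarked; every other vertex of the unmarked region of `a₃` has at most two nonzero neighbours;
  no nonzero edge joins `a₃` to a mark; no nonzero edge joins a vertex of the region other than `u`
  to a mark (the hub is the region's only door to the marks) ⊢ (HMF).  No bound on `a₃`: `a₃` may be
  joined to `u` by several internally disjoint paths, carry cycles of unmarked degree-two vertices,
  whiskers, parallel edges — in the Simple reduct all of it is one edge `{a₃, u}` or nothing, and the
  lifting lemma shows that no contracted path can join `a₃` to a mark past the hub.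

Own code; standard axioms.
-/

open scoped Classical

namespace Summit.Ventures.PercRepro2

open UnionCluster CovForm

namespace Skeleton

section WalkDefs

variable {V : Type*} {E : Type*} {R : Type*} [Field R]

/-- `v` is none of the five marks. -/
def Unmarked (o a₁ a₂ a₃ b v : V) : Prop := v ≠ o ∧ v ≠ a₁ ∧ v ≠ a₂ ∧ v ≠ a₃ ∧ v ≠ b

/-- `v` carries no nonzero edge. -/
def IsolatedIn (q : E → R) (ends' : E → Sym2 V) (v : V) : Prop := ∀ e, q e ≠ 0 → v ∉ ends' e

/-- A walk of nonzero edges from `x` to `y` whose interior vertices all satisfy `P`. -/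
inductive NzWalk (p : E → R) (ends : E → Sym2 V) (P : V → Prop) : V → V → Prop
  | single {x y : V} {e : E} (he : p e ≠ 0) (hxy : ends e = s(x, y)) : NzWalk p ends P x y
  | cons {x v y : V} {e : E} (he : p e ≠ 0) (hxv : ends e = s(x, v)) (hv : P v)
      (hw : NzWalk p ends P v y) : NzWalk p ends P x y

/-- Concatenation of walks through an interior vertex satisfying `P`. -/
theorem NzWalk.append {p : E → R} {ends : E → Sym2 V} {P : V → Prop} {x v y : V}
    (h₁ : NzWalk p ends P x v) (hv : P v) (h₂ : NzWalk p ends P v y) : NzWalk p ends P x y := by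
  induction h₁ with
  | single he hxy => exact NzWalk.cons he hxy hv h₂
  | cons he hxv hv' _ ih => exact NzWalk.cons he hxv hv' (ih hv h₂)

/-- Walks reverse. -/
theorem NzWalk.symm {p : E → R} {ends : E → Sym2 V} {P : V → Prop} {x y : V}
    (h : NzWalk p ends P x y) : NzWalk p ends P y x := by
  induction h with
  | single he hxy => exact NzWalk.single he (by rw [hxy, Sym2.eq_swap])
  | cons he hxv hv _ ih => exact ih.append hv (NzWalk.single he (by rw [hxv, Sym2.eq_swap]))

/-- Weakening the interior property. -/
theorem NzWalk.mono {p : E → R} {ends : E → Sym2 V} {P P' : V → Prop} (hPP : ∀ v, P v → P' v)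
    {x y : V} (h : NzWalk p ends P x y) : NzWalk p ends P' x y := by
  induction h with
  | single he hxy => exact NzWalk.single he hxy
  | cons he hxv hv _ ih => exact NzWalk.cons he hxv (hPP _ hv) ih

/-- A walk is a single edge or ends with an interior vertex joined to `y` by a nonzero edge. -/
theorem NzWalk.last {p : E → R} {ends : E → Sym2 V} {P : V → Prop} {x y : V}
    (h : NzWalk p ends P x y) :
    (∃ e, p e ≠ 0 ∧ ends e = s(x, y)) ∨
      ∃ v, P v ∧ (∃ e, p e ≠ 0 ∧ ends e = s(v, y)) ∧ NzWalk p ends P x v := by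
  induction h with
  | single he hxy => exact Or.inl ⟨_, he, hxy⟩
  | cons he hxv hv _ ih =>
    rcases ih with ⟨e', he', hvy⟩ | ⟨v', hv', hv'y, hw⟩
    · exact Or.inr ⟨_, hv, ⟨e', he', hvy⟩, NzWalk.single he hxv⟩
    · exact Or.inr ⟨v', hv', hv'y, NzWalk.cons he hxv hv hw⟩

/-- A walk from `a₃` whose interior vertices are unmarked ends in the unmarked region of `a₃` if its
end is unmarked. -/
theorem inRegion_of_nzWalk {p : E → R} {ends : E → Sym2 V} {o a₁ a₂ a₃ b : V} {P : V → Prop}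
    (hP : ∀ v, P v → Unmarked o a₁ a₂ a₃ b v) {y : V} (h : NzWalk p ends P a₃ y)
    (hy : Unmarked o a₁ a₂ a₃ b y) : InRegion p ends o a₁ a₂ a₃ b y := by
  suffices key : ∀ x y, NzWalk p ends P x y → Unmarked o a₁ a₂ a₃ b y →
      Relation.TransGen (UAdj p ends o a₁ a₂ a₃ b) x y from key _ _ h hy
  intro x y h hy
  induction h with
  | single he hxy => exact Relation.TransGen.single ⟨⟨_, he, hxy⟩, hy⟩
  | cons he hxv hv _ ih =>
    exact Relation.TransGen.head ⟨⟨_, he, hxv⟩, hP _ hv⟩ (ih hy)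

end WalkDefs

section Lift

variable {V : Type*} {E : Type*} [DecidableEq E] {R : Type*} [Field R]

variable {o a₁ a₂ a₃ b : V}

/-- A vertex without nonzero edges stays without nonzero edges under a move. -/
lemma isolatedIn_of_step {I J : (E → R) × (E → Sym2 V)} (h : Step o a₁ a₂ a₃ b I J) {z : V}
    (hz : IsolatedIn I.1 I.2 z) : IsolatedIn J.1 J.2 z := by
  intro e he hze
  cases h with
  | @reroute p ends ends' hr =>
    dsimp only at he hze
    exact hz e he (by dsimp only; rw [hr e he]; exact hze)
  | @loop p ends f _ _ =>
    dsimp only at he hze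
    by_cases hef : e = f
    · subst hef; simp at he
    · rw [Function.update_of_ne hef] at he; exact hz e he hze
  | @leaf p ends f _ _ _ _ _ _ _ _ _ _ =>
    dsimp only at he hze
    by_cases hef : e = f
    · subst hef; simp at he
    · rw [Function.update_of_ne hef] at he; exact hz e he hze
  | @series p ends f f' v w w' hff hf hf' hdeg _ _ _ _ _ _ _ =>
    dsimp only at he hze
    by_cases hef' : e = f'
    · subst hef'; simp at he
    rw [Function.update_of_ne hef'] at he
    by_cases hef : e = f
    · subst hef
      rw [Function.update_self] at he hze
      have hpf : p e ≠ 0 := left_ne_zero_of_mul he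
      have hpf' : p f' ≠ 0 := right_ne_zero_of_mul he
      have hzw : z ≠ w := fun hh =>
        hz e hpf (by dsimp only; rw [hf, hh]; exact Sym2.mem_mk_right v w)
      have hzw' : z ≠ w' := fun hh =>
        hz f' hpf' (by dsimp only; rw [hf', hh]; exact Sym2.mem_mk_right v w')
      rcases Sym2.mem_iff.1 hze with hh | hh
      · exact hzw hh
      · exact hzw' hh
    · rw [Function.update_of_ne hef] at he hze
      exact hz e he hze
  | @merge p ends e₁ e₂ hne hpar =>
    dsimp only at he hze
    by_cases he2 : e = e₂
    · subst he2; simp at he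
    rw [Function.update_of_ne he2] at he
    by_cases he1 : e = e₁
    · subst he1
      rw [Function.update_self] at he
      by_cases h2 : p e₂ = 0
      · refine hz e ?_ hze
        intro h0; dsimp only at h0; apply he; rw [h0, h2]; ring
      · exact hz e₂ h2 (by dsimp only; rw [← hpar]; exact hze)
    · rw [Function.update_of_ne he1] at he
      exact hz e he hze

/-- **Every nonzero edge of a reduct is the contraction of a walk of the instance** whose interior
vertices are unmarked and carry no nonzero edge in the reduct. -/
theorem nzWalk_of_reduces {I J : (E → R) × (E → Sym2 V)} (h : Reduces o a₁ a₂ a₃ b I J) :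
    ∀ e, J.1 e ≠ 0 → ∀ x y, J.2 e = s(x, y) →
      NzWalk I.1 I.2 (fun v => Unmarked o a₁ a₂ a₃ b v ∧ IsolatedIn J.1 J.2 v) x y := by
  induction h with
  | refl => intro e he x y hxy; exact NzWalk.single he hxy
  | @tail J' J hab hbc ih =>
    intro e he x y hxy
    have mono : ∀ {x y : V},
        NzWalk I.1 I.2 (fun v => Unmarked o a₁ a₂ a₃ b v ∧ IsolatedIn J'.1 J'.2 v) x y →
        NzWalk I.1 I.2 (fun v => Unmarked o a₁ a₂ a₃ b v ∧ IsolatedIn J.1 J.2 v) x y :=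
      fun hw => hw.mono fun v hv => ⟨hv.1, isolatedIn_of_step hbc hv.2⟩
    cases hbc with
    | @reroute p ends ends' hr =>
      dsimp only at he hxy
      exact mono (ih e he x y (by dsimp only; rw [hr e he]; exact hxy))
    | @loop p ends f _ _ =>
      dsimp only at he hxy
      by_cases hef : e = f
      · subst hef; simp at he
      · rw [Function.update_of_ne hef] at he; exact mono (ih e he x y hxy)
    | @leaf p ends f _ _ _ _ _ _ _ _ _ _ =>
      dsimp only at he hxy
      by_cases hef : e = f
      · subst hef; simp at he
      · rw [Function.update_of_ne hef] at he; exact mono (ih e he x y hxy)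
    | @series p ends f f' v w w' hff hf hf' hdeg hvw hvw' hvo hv1 hv2 hv3 hvb =>
      dsimp only at he hxy
      by_cases hef' : e = f'
      · subst hef'; simp at he
      rw [Function.update_of_ne hef'] at he
      by_cases hef : e = f
      · subst hef
        rw [Function.update_self] at he hxy
        have hpf : p e ≠ 0 := left_ne_zero_of_mul he
        have hpf' : p f' ≠ 0 := right_ne_zero_of_mul he
        -- the contracted vertex `v` is unmarked and isolated in `J`
        have hviso : IsolatedIn (Function.update (Function.update p e (p e * p f')) f' 0)
            (Function.update ends e s(w, w')) v := by
          intro e'' he'' hve''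
          by_cases h2 : e'' = f'
          · subst h2; simp at he''
          rw [Function.update_of_ne h2] at he''
          by_cases h1 : e'' = e
          · subst h1
            rw [Function.update_self] at hve''
            rcases Sym2.mem_iff.1 hve'' with hh | hh
            · exact hvw hh
            · exact hvw' hh
          · rw [Function.update_of_ne h1] at he'' hve''
            rcases hdeg e'' hve'' with hh | hh
            · exact h1 hh
            · exact h2 hh
        have hwv := mono (ih e hpf w v (by dsimp only; rw [hf, Sym2.eq_swap]))
        have hvw'' := mono (ih f' hpf' v w' hf')
        rcases Sym2.eq_iff.1 hxy with ⟨hxw, hyw'⟩ | ⟨hyw, hxw'⟩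
        · subst hxw; subst hyw'
          exact hwv.append ⟨⟨hvo.symm, hv1.symm, hv2.symm, hv3.symm, hvb.symm⟩, hviso⟩ hvw''
        · subst hyw; subst hxw'
          exact hvw''.symm.append ⟨⟨hvo.symm, hv1.symm, hv2.symm, hv3.symm, hvb.symm⟩, hviso⟩
            hwv.symm
      · rw [Function.update_of_ne hef] at he hxy
        exact mono (ih e he x y hxy)
    | @merge p ends e₁ e₂ hne hpar =>
      dsimp only at he hxy
      by_cases he2 : e = e₂
      · subst he2; simp at he
      rw [Function.update_of_ne he2] at he
      by_cases he1 : e = e₁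
      · subst he1
        rw [Function.update_self] at he
        by_cases h2 : p e₂ = 0
        · refine mono (ih e ?_ x y hxy)
          intro h0; dsimp only at h0; apply he; rw [h0, h2]; ring
        · exact mono (ih e₂ h2 x y (by dsimp only; rw [← hpar]; exact hxy))
      · rw [Function.update_of_ne he1] at he
        exact mono (ih e he x y hxy)

end Lift

section Hub

variable {V : Type*} {E : Type*} [Fintype E] [DecidableEq E] [Fintype V] [DecidableEq V]
  {R : Type*} [Field R] [LinearOrder R] [IsStrictOrderedRing R]

variable {o a₁ a₂ a₃ b : V}

/-- **(HMF) on the one-hub class of the unmarked region**: `u` unmarked; every other vertex of the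
unmarked region of `a₃` with at most two nonzero neighbours; no nonzero edge from `a₃` to a mark; no
nonzero edge from a vertex of the region other than `u` to a mark; the five marks distinct ⊢ (HMF). -/
theorem HMF_of_region_hub (p : E → R) (ends : E → Sym2 V) (hp : IsProbVec p) (u : V)
    (huo : u ≠ o) (hu1 : u ≠ a₁) (hu2 : u ≠ a₂) (hu3 : u ≠ a₃) (hub : u ≠ b)
    (hinj : Function.Injective (Hub3.markOf3 o a₁ a₂ a₃ b))
    (hnbr : ∀ v, v ≠ u → InRegion p ends o a₁ a₂ a₃ b v → (nzNbr p ends v).card ≤ 2)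
    (h3 : ∀ e, p e ≠ 0 → ∀ y, ends e = s(a₃, y) → y ≠ o ∧ y ≠ a₁ ∧ y ≠ a₂ ∧ y ≠ b)
    (hdoor : ∀ v, v ≠ u → InRegion p ends o a₁ a₂ a₃ b v → ∀ e, p e ≠ 0 → ∀ m, ends e = s(v, m) →
      m ≠ o ∧ m ≠ a₁ ∧ m ≠ a₂ ∧ m ≠ b) :
    HMF p ends o a₁ a₂ a₃ b := by
  have h31 : a₃ ≠ a₁ := hinj.ne (by decide : Hub.Mark.a₃ ≠ Hub.Mark.a₁)
  have h32 : a₃ ≠ a₂ := hinj.ne (by decide : Hub.Mark.a₃ ≠ Hub.Mark.a₂)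
  have h3o : a₃ ≠ o := hinj.ne (by decide : Hub.Mark.a₃ ≠ Hub.Mark.o)
  have h3b : a₃ ≠ b := hinj.ne (by decide : Hub.Mark.a₃ ≠ Hub.Mark.b)
  obtain ⟨J, hJ, hJs⟩ := exists_reduces_simple o a₁ a₂ a₃ b p ends hp
  obtain ⟨q, ends'⟩ := J
  -- every vertex of the region other than `u` has no nonzero edge in the reduct
  have hiso : ∀ v, v ≠ u → InRegion q ends' o a₁ a₂ a₃ b v → ∀ e, q e ≠ 0 → v ∉ ends' e := by
    intro v hvu hv e he hve
    exact notMem_of_simple_of_inRegion hJ hJs hv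
      (hnbr v hvu (inRegion_of_reduces (I := (p, ends)) (J := (q, ends')) hJ hv)) he hve
  have hlift := nzWalk_of_reduces (I := (p, ends)) (J := (q, ends')) hJ
  obtain ⟨-, hnoloop, hnopar⟩ := hJs
  dsimp only at hnoloop hnopar
  by_cases hex : ∃ e, q e ≠ 0 ∧ ∃ y, ends' e = s(a₃, y) ∧ y ≠ o ∧ y ≠ a₁ ∧ y ≠ a₂ ∧ y ≠ a₃ ∧ y ≠ b
  · obtain ⟨f, hqf, y, hy, hyo, hy1, hy2, hy3, hyb⟩ := hex
    have hyreg : InRegion q ends' o a₁ a₂ a₃ b y := inRegion_of_edge hy hqf hyo hy1 hy2 hy3 hyb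
    -- the unmarked neighbour of `a₃` is the hub
    have hyu : y = u := by
      by_contra hyu
      exact hiso y hyu hyreg f hqf (by rw [hy]; exact Sym2.mem_mk_right a₃ y)
    rw [hyu] at hy hyreg
    -- no nonzero edge of the reduct joins `a₃` to a mark: it would be a contracted walk of the
    -- instance leaving the region through a vertex other than the hub, or through the hub — which is
    -- not contracted, since it carries the edge `f`
    have hnomark : ∀ e, q e ≠ 0 → ∀ z, ends' e = s(a₃, z) → z ≠ o ∧ z ≠ a₁ ∧ z ≠ a₂ ∧ z ≠ b := by
      intro e he z hz
      by_contra hzm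
      have hw := hlift e he a₃ z hz
      rcases hw.last with ⟨e', he', hz'⟩ | ⟨v, ⟨hvU, hviso⟩, ⟨e', he', hvz⟩, hwv⟩
      · exact hzm (h3 e' he' z hz')
      · have hvreg : InRegion p ends o a₁ a₂ a₃ b v :=
          inRegion_of_nzWalk (fun _ hv => hv.1) hwv hvU
        by_cases hvu : v = u
        · subst hvu
          exact hviso f hqf (by dsimp only; rw [hy]; exact Sym2.mem_mk_right a₃ v)
        · exact hzm (hdoor v hvu hvreg e' he' z hvz)
    -- every nonzero edge at `a₃` is `f`
    have hleaf : ∀ e, q e ≠ 0 → a₃ ∈ ends' e → e = f := by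
      intro e he hae
      obtain ⟨z, hz⟩ := Sym2.mem_iff_exists.1 hae
      have hz3 : z ≠ a₃ := by
        intro hh; subst hh
        exact hnoloop e he (by rw [hz]; exact Sym2.mk_isDiag_iff.2 rfl)
      obtain ⟨hzo, hz1, hz2, hzb⟩ := hnomark e he z hz
      have hzreg : InRegion q ends' o a₁ a₂ a₃ b z := inRegion_of_edge hz he hzo hz1 hz2 hz3 hzb
      have hzu : z = u := by
        by_contra hzu
        exact hiso z hzu hzreg e he (by rw [hz]; exact Sym2.mem_mk_right a₃ z)
      by_contra hef
      exact hnopar e f he hqf hef (by rw [hz, hzu, hy])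
    refine HMF_of_reduces_leaf_hub hp hJ hy hqf hleaf ?_ hu3.symm h3o h31 h32 h3b hu1 hu2 huo hub
    intro e he hue
    obtain ⟨z, hz⟩ := Sym2.mem_iff_exists.1 hue
    by_cases hzu : z = u
    · exfalso; subst hzu
      exact hnoloop e he (by rw [hz]; exact Sym2.mk_isDiag_iff.2 rfl)
    by_cases hz3 : z = a₃
    · left; rw [hz, hz3]
    by_cases hz1 : z = a₁
    · right; left; rw [hz, hz1]
    by_cases hz2 : z = a₂
    · right; right; left; rw [hz, hz2]
    by_cases hzo : z = o
    · right; right; right; left; rw [hz, hzo]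
    by_cases hzb : z = b
    · right; right; right; right; left; rw [hz, hzb]
    exfalso
    exact hiso z hzu (inRegion_tail hyreg hz he hzo hz1 hz2 hz3 hzb) e he
      (by rw [hz]; exact Sym2.mem_mk_right u z)
  · -- no unmarked neighbour of `a₃` in the reduct: every nonzero edge at `a₃` joins it to a mark
    refine HMF_of_reduces_marks_at_a3 hp hJ ?_ h31 h32 h3o h3b
    intro e he hae
    obtain ⟨y, hy⟩ := Sym2.mem_iff_exists.1 hae
    have hy3 : y ≠ a₃ := by
      intro hh; subst hh
      exact hnoloop e he (by rw [hy]; exact Sym2.mk_isDiag_iff.2 rfl)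
    by_cases hy1 : y = a₁
    · left; rw [hy, hy1]
    by_cases hy2 : y = a₂
    · right; left; rw [hy, hy2]
    by_cases hyo : y = o
    · right; right; left; rw [hy, hyo]
    by_cases hyb : y = b
    · right; right; right; rw [hy, hyb]
    exact absurd ⟨e, he, y, hy, hyo, hy1, hy2, hy3, hyb⟩ hex

/-- **(HCOV) on the one-hub class of the unmarked region.** -/
theorem HCov_of_region_hub (p : E → R) (ends : E → Sym2 V) (hp : IsProbVec p) (u : V)
    (huo : u ≠ o) (hu1 : u ≠ a₁) (hu2 : u ≠ a₂) (hu3 : u ≠ a₃) (hub : u ≠ b)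
    (hinj : Function.Injective (Hub3.markOf3 o a₁ a₂ a₃ b))
    (hnbr : ∀ v, v ≠ u → InRegion p ends o a₁ a₂ a₃ b v → (nzNbr p ends v).card ≤ 2)
    (h3 : ∀ e, p e ≠ 0 → ∀ y, ends e = s(a₃, y) → y ≠ o ∧ y ≠ a₁ ∧ y ≠ a₂ ∧ y ≠ b)
    (hdoor : ∀ v, v ≠ u → InRegion p ends o a₁ a₂ a₃ b v → ∀ e, p e ≠ 0 → ∀ m, ends e = s(v, m) →
      m ≠ o ∧ m ≠ a₁ ∧ m ≠ a₂ ∧ m ≠ b) :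
    HCov p ends o a₁ a₂ a₃ b :=
  HCov_of_HMF p hp ends o a₁ a₂ a₃ b
    (HMF_of_region_hub p ends hp u huo hu1 hu2 hu3 hub hinj hnbr h3 hdoor)

end Hub

end Skeleton

end Summit.Ventures.PercRepro2
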